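import Mathlib
import HarnessLib
import Summits.NavierStokesRegularity.NavierStokesRegularity.Theses.RootDecompIntermittency
import Summits.NavierStokesRegularity.NavierStokesRegularity.Theorems.RootDecompIntermittencyNoThinFrontierBlowupStubCs14Criterion
import Summits.NavierStokesRegularity.NavierStokesRegularity.Theorems.RootDecompIntermittencyNoThinFrontierBlowupStubFrontierL2Apriori

/-!
# RootDecompIntermittency — crux X₁ `NoThinFrontierBlowup` (stmt-NavierStokesRegularity-27233) is ONE registered stub, in the tree

The registered first-prover skeleton of X₁ (writer g11, skeleton sha `37d94a075230…`, mirror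
`HOME/writer/g11/NoThinFrontierBlowup_line.lean`) has three stubs: `stub_cs14Criterion` (the Cheskidov–Shvydkoy 2014 /
Cheskidov–Dai 2015 CRITERION leg — a TREE THEOREM since writer g13's p796816), `stub_frontierL2Apriori` (a 1-thin frontier
gives `∫ Λ² < ∞` — a TREE THEOREM since census g24's p792929) and `stub_thickBelowThinDeficit` (THE OPEN LEMMA of X₁:
under a 1-thin frontier the low-mode Lipschitz functional obeys `f(t) ≤ K·Λ(t)²`; Bernstein alone gives `Λ^{5/2}`). The
skeleton's composition `NoThinFrontierBlowup_of` lives only in the (unlanded) mirror; this file lands it: the born route decl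
`Theses.RootDecompIntermittency.NoThinFrontierBlowup` follows from the registered signature of `stub_thickBelowThinDeficit`,
taken VERBATIM as a hypothesis (no new definition), by the writer's composition over the two landed stubs
(`∫ f ≤ K ∫ Λ² < ∞` on `(max t₀ 0, T)` ⟹ extension past `T`). Hence the crux ⟨27233⟩ is, in the tree and by name, exactly the
one open stub — the third such crux after ⟨1222⟩ (wall `StubScalarLiouville`, p793469) and ⟨25378⟩
(`stub_logGaugePointBounded`, p796755). Conditional; credits nothing; Navier–Stokes regularity is NOT proved by anything here
(rung 0). decomp-ns census instrument g26. [cite: arXiv:1102.1944, Thm. 3.1 (Cheskidov–Shvydkoy 2014); arXiv:1507.06611]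
-/

-- the summit and its single sub-problem share the name (CONVENTIONS §1), as in every Theorems file
set_option linter.dupNamespace false

namespace Summit.NavierStokesRegularity.NavierStokesRegularity.Theorems.NoThinFrontierBlowup

open Summit.NavierStokesRegularity.NavierStokesRegularity.Theses.RootDecompIntermittency

/-- **Crux ⟨27233⟩ modulo its one mathematical stub.** The registered signature of `stub_thickBelowThinDeficit` (hypothesis
`hF2`, verbatim: under a 1-thin Kolmogorov frontier on `(t₀, T)` the low-mode Lipschitz functional is bounded by `K·Λ²`
pointwise in time) implies the route decl `NoThinFrontierBlowup`: combine with the landed `stub_frontierL2Apriori`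
(`∫ Λ² < ∞`) and feed `∫ f < ∞` to the landed criterion `stub_cs14Criterion`. [writer g11 composition
`NoThinFrontierBlowup_of`, re-targeted; arXiv:1102.1944 Thm 3.1] -/
theorem noThinFrontierBlowup_of_stubThickBelowThinDeficit
    (hF2 : ∀ c₀ : ℝ, 0 < c₀ → c₀ ≤ 1 → ∀ (ν T : ℝ), 0 < ν → 0 < T → ∀ (u : ℝ → EuclideanSpace ℝ (Fin 3) → EuclideanSpace ℝ (Fin 3)) (p : ℝ → EuclideanSpace ℝ (Fin 3) → ℝ), Literature.Analysis.FluidPDE.IsClassicalNSSolutionOn (Set.Ico 0 T) ν 0 u p → Literature.Analysis.FluidPDE.IsLerayHopfOn T ν 0 (u 0) u → Literature.Analysis.FluidPDE.HasRapidSpatialDecay (u 0) → ∀ C t₀ : ℝ, 0 ≤ t₀ → t₀ < T → (∀ t ∈ Set.Ioo t₀ T, ∀ j : ℕ, (Literature.Analysis.FluidPDE.IsSaturatedLevel c₀ ν (u t) j ∧ ∀ k : ℕ, j < k → ¬ Literature.Analysis.FluidPDE.IsSaturatedLevel c₀ ν (u t) k) → MeasureTheory.eLpNorm (Literature.Analysis.FunctionSpaces.blockFn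 (j : ℤ) (u t)) ⊤ MeasureTheory.volume ≤ ENNReal.ofReal (C * (2 : ℝ) ^ ((3 - (1 : ℝ)) / 2 * (j : ℝ))) * MeasureTheory.eLpNorm (Literature.Analysis.FunctionSpaces.blockFn (j : ℤ) (u t)) 2 MeasureTheory.volume) → ∃ K : NNReal, ∀ t ∈ Set.Ioo t₀ T, (⨆ (j : ℕ) (_ : (2 : ENNReal) ^ j ≤ Literature.Analysis.FluidPDE.dissipationWavenumber c₀ ν (u t)), (2 : ENNReal) ^ j * MeasureTheory.eLpNorm (Literature.Analysis.FunctionSpaces.blockFn (j : ℤ) (u t)) ⊤ MeasureTheory.volume) ≤ (K : ENNReal) * Literature.Analysis.FluidPDE.dissipationWavenumber c₀ ν (u t) ^ 2) :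
    NoThinFrontierBlowup := by
  intro ν T hν hT u p hcl hLH hdec hthin
  obtain ⟨cs, hcs, hcs1, hcrit⟩ := stub_cs14Criterion
  obtain ⟨C, t₀, ht₀T, hth⟩ := hthin cs hcs hcs1
  have ht₁T : max t₀ 0 < T := max_lt ht₀T hT
  have hsub : Set.Ioo (max t₀ 0) T ⊆ Set.Ioo t₀ T := Set.Ioo_subset_Ioo_left (le_max_left _ _)
  have hth' : ∀ t ∈ Set.Ioo (max t₀ 0) T, ∀ j : ℕ, (Literature.Analysis.FluidPDE.IsSaturatedLevel cs ν (u t) j ∧ ∀ k : ℕ, j < k → ¬ Literature.Analysis.FluidPDE.IsSaturatedLevel cs ν (u t) k) → MeasureTheory.eLpNorm (Literature.Analysis.FunctionSpaces.blockFn (j : ℤ) (u t)) ⊤ MeasureTheory.volume ≤ ENNReal.ofReal (C * (2 : ℝ) ^ ((3 - (1 : ℝ)) / 2 * (j : ℝ))) * MeasureTheory.eLpNorm (Literature.Analysis.FunctionSpaces.blockFn (j : ℤ) (u t)) 2 MeasureTheory.volume :=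
    fun t ht j hj => hth t (hsub ht) j hj
  have hL2 := stub_frontierL2Apriori cs hcs hcs1 ν T hν hT u p hcl hLH C (max t₀ 0) (le_max_right _ _) ht₁T hth'
  obtain ⟨K, hK⟩ := hF2 cs hcs hcs1 ν T hν hT u p hcl hLH hdec C (max t₀ 0) (le_max_right _ _) ht₁T hth'
  have hint : (∫⁻ t in Set.Ioo (max t₀ 0) T, (⨆ (j : ℕ) (_ : (2 : ENNReal) ^ j ≤ Literature.Analysis.FluidPDE.dissipationWavenumber cs ν (u t)), (2 : ENNReal) ^ j * MeasureTheory.eLpNorm (Literature.Analysis.FunctionSpaces.blockFn (j : ℤ) (u t)) ⊤ MeasureTheory.volume)) < ⊤ := by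
    calc (∫⁻ t in Set.Ioo (max t₀ 0) T, (⨆ (j : ℕ) (_ : (2 : ENNReal) ^ j ≤ Literature.Analysis.FluidPDE.dissipationWavenumber cs ν (u t)), (2 : ENNReal) ^ j * MeasureTheory.eLpNorm (Literature.Analysis.FunctionSpaces.blockFn (j : ℤ) (u t)) ⊤ MeasureTheory.volume))
        ≤ ∫⁻ t in Set.Ioo (max t₀ 0) T, (K : ENNReal) * Literature.Analysis.FluidPDE.dissipationWavenumber cs ν (u t) ^ 2 :=
          MeasureTheory.setLIntegral_mono' measurableSet_Ioo fun t ht => hK t ht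
      _ = (K : ENNReal) * ∫⁻ t in Set.Ioo (max t₀ 0) T, Literature.Analysis.FluidPDE.dissipationWavenumber cs ν (u t) ^ 2 :=
          MeasureTheory.lintegral_const_mul' _ _ ENNReal.coe_ne_top
      _ < ⊤ := ENNReal.mul_lt_top ENNReal.coe_lt_top hL2
  exact hcrit cs hcs le_rfl ν T hν hT u p hcl hLH hdec (max t₀ 0) (le_max_right _ _) ht₁T hint

end Summit.NavierStokesRegularity.NavierStokesRegularity.Theorems.NoThinFrontierBlowup
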